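import Literature.Probability.Percolation.CellGeometry
import HarnessLib

/-!
# Tile geometry of bond percolation on `ℤ²`: site, bond and face cells

Topic `Probability/Percolation`.  Fifth step of the cell-complex toolkit for the gluing theorem
(Schramm–Smirnov 2011, proof of Thm 1.5, step (C)).  Bond percolation on `ℤ²` is drawn on the grid
of mesh `1/2` ("tile geometry"): the vertex `v` owns the **site cell** `σ v = 2v`, the edge
`{v, v + e_k}` the **bond cell** `β v k = 2v + e_k`, the face with lower-left corner `f` the **face
cell** `φ f = 2f + (1,1)`.  Declaring site cells open and face cells closed, open clusters and closed
dual clusters become side-connected unions of tiles and interfaces become disjoint simple curves; in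
particular there are no checkerboard corners.  Here:

* parities and the decomposition of every grid corner as `2v + cornerOff j` (`exists_corner_eq`),
  with the four cells around it identified (`faceAt_corner_self` … `faceAt_corner_add_three`);
* `pinchFree_of_patterns` — a cell set `U` is pinch-free as soon as the two checkerboard patterns
  "site and face in, both bonds out" and "both bonds in, site and face out" are excluded at every
  `(v, j)`;
* `isPreconnected_edge_inter_Kset` / `isPreconnected_dualEdge_inter_Kset` — tameness of the drawn
  primal edge `σ v → σ (v + e_k)` and of the drawn dual edge `φ f → φ (f + e_k)` under the no-slit
  conditions, from `isPreconnected_seg2_inter_Kset`.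

Everything is proved; no named fact is introduced.

## References

* O. Schramm, S. Smirnov, Ann. Probab. 39 (2011), arXiv:1101.5820, proof of Thm 1.5 (C). [SchrammSmirnov2011]
* G. Grimmett, *Percolation* (1999), §11.2 (planar duality). [GrimmettPercolation1999]
-/

noncomputable section

open Set Metric
open Literature.Probability.LatticeModels

namespace Literature.Probability.Percolation

namespace CellComplex

/-! ### The three kinds of cells -/

/-- The site cell of the vertex `v`. [folklore] -/
def σc (v : Site 2) : Site 2 := v + v

/-- The bond cell of the edge from `v` in direction `k`. [folklore] -/
def βc (v : Site 2) (k : Fin 4) : Site 2 := v + v + cornerUnit k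

/-- The face cell of the face with lower-left corner `f`. [folklore] -/
def φc (f : Site 2) : Site 2 := f + f + (Pi.single 0 1 + Pi.single 1 1)

/-- The bond cell does not depend on the orientation of the edge. [folklore] -/
theorem βc_rev (v : Site 2) (k : Fin 4) : βc (v + cornerUnit k) (k + 2) = βc v k := by
  rw [βc, βc, cornerUnit_add_two]; abel

/-- Coordinates of the site cell. [folklore] -/
@[simp] theorem σc_apply (v : Site 2) (i : Fin 2) : σc v i = 2 * v i := by
  simp [σc, two_mul]

/-- Coordinates of the face cell. [folklore] -/
theorem φc_apply (f : Site 2) (i : Fin 2) : φc f i = 2 * f i + 1 := by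
  fin_cases i <;> simp [φc, two_mul]

/-- Coordinates of the bond cell. [folklore] -/
theorem βc_apply (v : Site 2) (k : Fin 4) (i : Fin 2) : βc v k i = 2 * v i + cornerUnit k i := by
  simp [βc, two_mul]

/-- The next site cell is two steps away. [folklore] -/
theorem σc_add_cornerUnit (v : Site 2) (k : Fin 4) :
    σc (v + cornerUnit k) = σc v + cornerUnit k + cornerUnit k := by
  rw [σc, σc]; abel

/-- The bond cell is one step away from the site cell. [folklore] -/
theorem βc_eq (v : Site 2) (k : Fin 4) : βc v k = σc v + cornerUnit k := rfl

/-- The next face cell is two steps away. [folklore] -/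
theorem φc_add_cornerUnit (f : Site 2) (k : Fin 4) :
    φc (f + cornerUnit k) = φc f + cornerUnit k + cornerUnit k := by
  rw [φc, φc]; abel

/-- The cell between two adjacent face cells is a bond cell: across the dual edge from `f` in
direction `k` lies the bond cell of the primal edge from the corner `f + cornerOff (k + 1)` of `f`
in direction `k + 1`. [folklore] -/
theorem φc_add_cornerUnit_eq_βc (f : Site 2) (k : Fin 4) :
    φc f + cornerUnit k = βc (f + cornerOff (k + 1)) (k + 1) := by
  funext i
  simp only [Pi.add_apply, φc_apply, βc_apply]
  fin_cases i <;> fin_cases k <;> simp [cornerUnit, cornerOff] <;> ring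

/-! ### Corners -/

/-- Every grid corner is `2v + cornerOff j` for a unique vertex `v` and quadrant `j`. [folklore] -/
theorem exists_corner_eq (w : Site 2) : ∃ (v : Site 2) (j : Fin 4), w = σc v + cornerOff j := by
  refine ⟨fun i => w i / 2, ?_⟩
  have h0 := Int.emod_two_eq_zero_or_one (w 0)
  have h1 := Int.emod_two_eq_zero_or_one (w 1)
  have d0 : w 0 % 2 + 2 * (w 0 / 2) = w 0 := Int.emod_add_mul_ediv (w 0) 2
  have d1 : w 1 % 2 + 2 * (w 1 / 2) = w 1 := Int.emod_add_mul_ediv (w 1) 2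
  rcases h0 with h0 | h0 <;> rcases h1 with h1 | h1
  · refine ⟨0, ?_⟩; funext i; fin_cases i <;> simp [cornerOff] <;> omega
  · refine ⟨3, ?_⟩; funext i; fin_cases i <;> simp [cornerOff] <;> omega
  · refine ⟨1, ?_⟩; funext i; fin_cases i <;> simp [cornerOff] <;> omega
  · refine ⟨2, ?_⟩; funext i; fin_cases i <;> simp [cornerOff] <;> omega

section Corner

variable (v : Site 2) (j : Fin 4)

/-- Around the corner `2v + cornerOff j`: the cell in position `j` is the site cell. [folklore] -/
theorem faceAt_corner_self : faceAt (σc v + cornerOff j) j = σc v := by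
  rw [faceAt]; abel

/-- … the cell in position `j + 2` is the face cell of `faceAt v (j + 2)`. [folklore] -/
theorem faceAt_corner_add_two : faceAt (σc v + cornerOff j) (j + 2) = φc (faceAt v (j + 2)) := by
  funext i
  simp only [faceAt, Pi.sub_apply, Pi.add_apply, σc_apply, φc_apply]
  fin_cases i <;> fin_cases j <;> simp [cornerOff] <;> ring

/-- … the cell in position `j + 1` is the bond cell in direction `j + 2`. [folklore] -/
theorem faceAt_corner_add_one : faceAt (σc v + cornerOff j) (j + 1) = βc v (j + 2) := by
  funext i
  simp only [faceAt, Pi.sub_apply, Pi.add_apply, σc_apply, βc_apply]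
  fin_cases i <;> fin_cases j <;> simp [cornerOff, cornerUnit] <;> ring

/-- … the cell in position `j + 3` is the bond cell in direction `j + 3`. [folklore] -/
theorem faceAt_corner_add_three : faceAt (σc v + cornerOff j) (j + 3) = βc v (j + 3) := by
  funext i
  simp only [faceAt, Pi.sub_apply, Pi.add_apply, σc_apply, βc_apply]
  fin_cases i <;> fin_cases j <;> simp [cornerOff, cornerUnit] <;> ring

end Corner

/-! ### Pinch-freeness from the two patterns -/

/-- **Pattern A** at `(v, j)`: site cell and diagonal face cell in `U`, the two bond cells between
them not. [folklore] -/
def PatternA (U : Finset (Site 2)) (v : Site 2) (j : Fin 4) : Prop :=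
  σc v ∈ U ∧ φc (faceAt v (j + 2)) ∈ U ∧ βc v (j + 2) ∉ U ∧ βc v (j + 3) ∉ U

/-- **Pattern B** at `(v, j)`: the two bond cells in `U`, site cell and face cell not. [folklore] -/
def PatternB (U : Finset (Site 2)) (v : Site 2) (j : Fin 4) : Prop :=
  βc v (j + 2) ∈ U ∧ βc v (j + 3) ∈ U ∧ σc v ∉ U ∧ φc (faceAt v (j + 2)) ∉ U

/-- **A cell set without patterns A and B is pinch-free.** [folklore] -/
theorem pinchFree_of_patterns {U : Finset (Site 2)} (hA : ∀ v j, ¬ PatternA U v j)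
    (hB : ∀ v j, ¬ PatternB U v j) : PinchFree U := by
  intro w k ⟨h0, h2, h1, h3⟩
  obtain ⟨v, j, rfl⟩ := exists_corner_eq w
  obtain ⟨i, rfl⟩ := fin4_exists_add j k
  have eS := faceAt_corner_self v j
  have eF := faceAt_corner_add_two v j
  have eB1 := faceAt_corner_add_one v j
  have eB3 := faceAt_corner_add_three v j
  fin_cases i
  · -- `k = j`: pattern A
    simp only [Fin.zero_eta, add_zero] at h0 h1 h2 h3
    rw [eS] at h0; rw [eF] at h2; rw [eB1] at h1; rw [eB3] at h3
    exact hA v j ⟨h0, h2, h1, h3⟩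
  · -- `k = j + 1`: pattern B
    simp only [Fin.mk_one] at h0 h1 h2 h3
    rw [eB1] at h0
    rw [fin4_add_one_add_two, eB3] at h2
    rw [fin4_add_one_add_one, eF] at h1
    rw [fin4_add_one_add_three, eS] at h3
    exact hB v j ⟨h0, h2, h3, h1⟩
  · -- `k = j + 2`: pattern A
    simp only [Fin.reduceFinMk] at h0 h1 h2 h3
    rw [eF] at h0
    rw [fin4_add_two_add_two', eS] at h2
    rw [fin4_add_two_add_one, eB3] at h1
    rw [fin4_add_two_add_three, eB1] at h3
    exact hA v j ⟨h2, h0, h3, h1⟩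
  · -- `k = j + 3`: pattern B
    simp only [Fin.reduceFinMk] at h0 h1 h2 h3
    rw [eB3] at h0
    rw [DiscreteDobrushin.fin4_three_two, eB1] at h2
    rw [fin4_add_three_add_one, eS] at h1
    rw [fin4_add_three_add_three, eF] at h3
    exact hB v j ⟨h2, h0, h1, h3⟩

/-! ### Tameness of drawn edges -/

/-- **Tameness of the drawn primal edge** `σ v → σ (v + e_k)`: if both site cells in `U` force the
bond cell in `U`, the drawn edge meets `K` in a preconnected set. [folklore] -/
theorem isPreconnected_edge_inter_Kset (U : Finset (Site 2)) (v : Site 2) (k : Fin 4)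
    (h : σc v ∈ U → σc (v + cornerUnit k) ∈ U → βc v k ∈ U) :
    IsPreconnected (segment ℝ (ctr (σc v)) (ctr (σc (v + cornerUnit k))) ∩ Kset U) := by
  rw [σc_add_cornerUnit]
  refine isPreconnected_seg2_inter_Kset U (σc v) k fun h1 h2 => ?_
  rw [← σc_add_cornerUnit] at h2
  exact h h1 h2

/-- **Tameness of the drawn dual edge** `φ f → φ (f + e_k)`: if both face cells in `U` force the bond
cell between them in `U`, the drawn dual edge meets `K` in a preconnected set. [folklore] -/
theorem isPreconnected_dualEdge_inter_Kset (U : Finset (Site 2)) (f : Site 2) (k : Fin 4)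
    (h : φc f ∈ U → φc (f + cornerUnit k) ∈ U → βc (f + cornerOff (k + 1)) (k + 1) ∈ U) :
    IsPreconnected (segment ℝ (ctr (φc f)) (ctr (φc (f + cornerUnit k))) ∩ Kset U) := by
  rw [φc_add_cornerUnit]
  refine isPreconnected_seg2_inter_Kset U (φc f) k fun h1 h2 => ?_
  rw [← φc_add_cornerUnit] at h2
  rw [φc_add_cornerUnit_eq_βc]
  exact h h1 h2

end CellComplex

end Literature.Probability.Percolation

end
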